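import Mathlib
import Literature.MathematicalPhysics.QuantumFieldTheory.Balaban1983to89.B5Projection127

/-!
# B5 p. 22 (Sect. C): the operator `Δ⁻¹` — «by Δ⁻¹ we denote its inverse on this subspace. We
# extend it to the whole space by linearity, putting its value on constant functions equal to 0.»

Source: T. Bałaban, *Propagators and renormalization transformations for lattice gauge
theories. I*, Commun. Math. Phys. 95 (1984) 17–40 (`Balaban1984PropagatorsI`, "B5"), render
`b2b-balaban-ref1/pages/1984-cmp95-propagators-rt-I/…-p006-x2.png` (PDF page 6 = journal page 22),
read as an image.

## What the paper prints (verbatim, p. 22, after (1.25))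

«… on the subspace orthogonal to constant functions the operator Δ is positive. Hence it is an
invertible operator and by Δ⁻¹ we denote its inverse on this subspace. We extend it to the whole
space by linearity, putting its value on constant functions equal to 0.»

## What is typed and certified here (kernel-checked, zero sorry)

For pass 7's position-space scalar `Δ = LapS N c = Σ_ν ∂_ν^*∂_ν` on any torus `Tor N` (lattice
factor `c`; B5: `c = η⁻¹ ≠ 0`) and pass 4's unitary DFT `dft N`:
* `dft_mul_shiftS`, `dft_mul_sdiff`, `dft_mul_LapS`, `LapS_eq` — the scalar Fourier
  diagonalisation `Δ = Uᴴ diag(Δ(p)) U`, `Δ(p) = lsym N c p = Σ_ν |c(e^{ip·e_ν} − 1)|²`;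
* `LapSinv N c := Uᴴ diag(Δ(p)⁻¹ if Δ(p) ≠ 0, else 0) U` — THE TYPED `Δ⁻¹` — and
  `Pker N c := Uᴴ diag(𝟙[Δ(p) = 0]) U`;
* `LapS_mul_LapSinv`, `LapSinv_mul_LapS` — `ΔΔ⁻¹ = Δ⁻¹Δ = I − Pker`; `LapSinv_conjTranspose`
  (`Δ⁻¹` Hermitian), `LapSinv_mul_Pker`, `LapS_mul_Pker`, `Pker_mul_Pker`, `Pker_conjTranspose`;
* `Pker_const`, `Pker_orth` — for `c ≠ 0`, by pass 17 (`ker Δ` = constants): `Pker f` is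
  constant and `Pker f = 0` for `f ⊥ 1`;
* `LapS_LapSinv_of_orth`, `LapSinv_LapS_of_orth` — «its inverse on this subspace»: `ΔΔ⁻¹f =
  Δ⁻¹Δf = f` for `Σ_x f(x) = 0` (`c ≠ 0`);
* `LapSinv_const` — «putting its value on constant functions equal to 0»: `Δ⁻¹(const) = 0`;
* `sum_LapSinv` — `Δ⁻¹` maps into the subspace orthogonal to constants («by linearity»: the
  typed `Δ⁻¹` is the linear extension described).
* `residual_eq_pinv`, `residual_eq_torus` — pass 18's substitution identity `b − ΔΔ⁻¹(I − Pc)b =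
  Pc b` RE-TYPED with pseudo-inverse hypotheses (`D L b = b`, `D L L = L`; answer to the cross-read
  objection GAPS G-adv2-27) and instantiated for the typed `Δ`, `Δ⁻¹` on the FULL torus, `b ⊥ 1`.
This supplies the `L = Δ⁻¹` (Hermitian) of pass 18 (`B5Projection127`); its `D·L = I` and
`Minv·(QL²Qᴴ) = I` hold for the printed objects only on the complements of the constants
(G-adv2-27), which is where B5 works («on the corresponding subspace»).

## What is NOT certified here

`Q′_kΔ⁻²Q′*_k` and its inverse in position space (fiberwise: passes 2/5); fields complex.
-/

open scoped BigOperators Matrix ComplexConjugate ComplexOrder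
open Finset Complex Matrix

namespace Literature.MathematicalPhysics.QuantumFieldTheory.Balaban1983to89.B5LaplaceInverse

open Literature.MathematicalPhysics.QuantumFieldTheory.Balaban1983to89.B5Prop11Plancherel
open Literature.MathematicalPhysics.QuantumFieldTheory.Balaban1983to89.B5Action121
open Literature.MathematicalPhysics.QuantumFieldTheory.Balaban1983to89.B5LaplaceSpectral
open Literature.MathematicalPhysics.QuantumFieldTheory.Balaban1983to89.B5Projection127

noncomputable section

variable {d : ℕ} (N : Fin d → ℕ) [hN : ∀ μ, NeZero (N μ)]

/-! ## §1 Scalar Fourier diagonalisation of `Δ` -/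

/-- `U U^* = 1`. [folklore] -/
theorem dft_mul_conjTranspose : dft N * (dft N)ᴴ = 1 := by
  rw [← Matrix.star_eq_conjTranspose]; exact dft_mul_star N

/-- `U^* U = 1`. [folklore] -/
theorem dft_conjTranspose_mul : (dft N)ᴴ * dft N = 1 := by
  have h := Matrix.mem_unitaryGroup_iff'.mp (dft_mem_unitaryGroup N)
  rwa [Matrix.star_eq_conjTranspose] at h

/-- `U S_ν = diag(e^{ip·e_ν}) U` for the scalar translation. [folklore] -/
theorem dft_mul_shiftS (ν : Fin d) :
    dft N * shiftS N ν
      = Matrix.diagonal (fun p : Tor N => (ZMod.stdAddChar (N := N ν)) (p ν)) * dft N := by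
  ext p y
  rw [Matrix.mul_apply, Matrix.diagonal_mul, Finset.sum_eq_single (y - unitVec N ν)]
  · rw [shiftS, if_pos (sub_add_cancel y (unitVec N ν)).symm, mul_one, dft_sub_unitVec]
  · intro x _ hx
    rw [shiftS, if_neg (fun h => hx (by rw [h, add_sub_cancel_right])), mul_zero]
  · intro h; exact absurd (Finset.mem_univ _) h

/-- the symbol `∂_ν(p) = c(e^{ip·e_ν} − 1)` of the scalar forward difference.
[cite: Balaban1984PropagatorsI, (1.31) p.23] -/
def ssym (c : ℂ) (ν : Fin d) : Tor N → ℂ :=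
  fun p => c * ((ZMod.stdAddChar (N := N ν)) (p ν) - 1)

/-- `U ∂_ν = diag(∂_ν(p)) U`. [folklore] -/
theorem dft_mul_sdiff (c : ℂ) (ν : Fin d) :
    dft N * sdiff N c ν = Matrix.diagonal (ssym N c ν) * dft N := by
  have hs : sdiff N c ν = c • (shiftS N ν - 1) := rfl
  rw [hs, Matrix.mul_smul, Matrix.mul_sub, Matrix.mul_one, dft_mul_shiftS]
  ext p y
  simp only [Matrix.smul_apply, Matrix.sub_apply, Matrix.diagonal_mul, ssym, smul_eq_mul]
  ring

/-- the symbol «Δ(p) = Σ_μ |∂_μ(p)|²» of the scalar Laplace operator.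
[cite: Balaban1984PropagatorsI, (1.31) p.23] -/
def lsym (c : ℂ) : Tor N → ℂ := fun p => ∑ ν, conj (ssym N c ν p) * ssym N c ν p

/-- `U ∂_ν^*∂_ν = diag(|∂_ν(p)|²) U`. [folklore] -/
theorem dft_mul_sdiffH_mul_sdiff (c : ℂ) (ν : Fin d) :
    dft N * ((sdiff N c ν)ᴴ * sdiff N c ν)
      = (Matrix.diagonal (ssym N c ν))ᴴ * Matrix.diagonal (ssym N c ν) * dft N := by
  have h := dft_mul_sdiff N c ν
  have hU1 := dft_mul_conjTranspose N
  have hU2 := dft_conjTranspose_mul N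
  have hH : (sdiff N c ν)ᴴ = (dft N)ᴴ * (Matrix.diagonal (ssym N c ν))ᴴ * dft N := by
    have h2 := congrArg Matrix.conjTranspose h
    rw [Matrix.conjTranspose_mul, Matrix.conjTranspose_mul] at h2
    calc (sdiff N c ν)ᴴ = (sdiff N c ν)ᴴ * ((dft N)ᴴ * dft N) := by rw [hU2, Matrix.mul_one]
      _ = (dft N)ᴴ * (Matrix.diagonal (ssym N c ν))ᴴ * dft N := by rw [← Matrix.mul_assoc, h2]
  calc dft N * ((sdiff N c ν)ᴴ * sdiff N c ν)
      = dft N * (dft N)ᴴ * (Matrix.diagonal (ssym N c ν))ᴴ * (dft N * sdiff N c ν) := by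
        rw [hH]; simp only [Matrix.mul_assoc]
    _ = (Matrix.diagonal (ssym N c ν))ᴴ * Matrix.diagonal (ssym N c ν) * dft N := by
        rw [hU1, Matrix.one_mul, h, Matrix.mul_assoc]

/-- `U Δ = diag(Δ(p)) U`. [cite: Balaban1984PropagatorsI, (1.31) p.23] -/
theorem dft_mul_LapS (c : ℂ) : dft N * LapS N c = Matrix.diagonal (lsym N c) * dft N := by
  unfold LapS
  rw [Finset.mul_sum]
  simp_rw [dft_mul_sdiffH_mul_sdiff]
  rw [← Finset.sum_mul]
  congr 1
  ext i j
  rw [Matrix.sum_apply]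
  simp_rw [Matrix.diagonal_conjTranspose, Matrix.diagonal_mul_diagonal]
  by_cases hij : i = j
  · subst hij
    simp only [Matrix.diagonal_apply_eq, Pi.star_apply, Complex.star_def, lsym]
  · simp only [Matrix.diagonal_apply_ne _ hij, Finset.sum_const_zero]

/-- `Δ = U^* diag(Δ(p)) U`. [folklore] -/
theorem LapS_eq (c : ℂ) : LapS N c = (dft N)ᴴ * Matrix.diagonal (lsym N c) * dft N := by
  calc LapS N c = (dft N)ᴴ * dft N * LapS N c := by rw [dft_conjTranspose_mul, Matrix.one_mul]
    _ = (dft N)ᴴ * Matrix.diagonal (lsym N c) * dft N := by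
        rw [Matrix.mul_assoc, dft_mul_LapS, ← Matrix.mul_assoc]

/-- `Δ(p)` is real: `conj Δ(p) = Δ(p)`. [folklore] -/
theorem conj_lsym (c : ℂ) (p : Tor N) : conj (lsym N c p) = lsym N c p := by
  simp only [lsym, map_sum, map_mul, Complex.conj_conj]
  exact Finset.sum_congr rfl fun ν _ => mul_comm _ _

/-! ## §2 The typed `Δ⁻¹` and the projection onto `ker Δ` -/

/-- the multiplier of `Δ⁻¹`: `Δ(p)⁻¹` where `Δ(p) ≠ 0`, `0` where `Δ(p) = 0`. [folklore] -/
def linv (c : ℂ) : Tor N → ℂ := fun p => if lsym N c p = 0 then 0 else 1 / lsym N c p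

/-- «by Δ⁻¹ we denote its inverse on this subspace … putting its value on constant functions equal
to 0»: `Δ⁻¹ := U^* diag(linv) U`. [cite: Balaban1984PropagatorsI, Sect. C p.22] -/
def LapSinv (c : ℂ) : Matrix (Tor N) (Tor N) ℂ := (dft N)ᴴ * Matrix.diagonal (linv N c) * dft N

/-- the spectral projection onto `ker Δ`: `U^* diag(𝟙[Δ(p) = 0]) U`. [folklore] -/
def Pker (c : ℂ) : Matrix (Tor N) (Tor N) ℂ :=
  (dft N)ᴴ * Matrix.diagonal (fun p => if lsym N c p = 0 then (1 : ℂ) else 0) * dft N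

/-- products of Fourier multipliers. [folklore] -/
theorem sandwich_mul (a b : Tor N → ℂ) :
    ((dft N)ᴴ * Matrix.diagonal a * dft N) * ((dft N)ᴴ * Matrix.diagonal b * dft N)
      = (dft N)ᴴ * Matrix.diagonal (fun p => a p * b p) * dft N := by
  calc ((dft N)ᴴ * Matrix.diagonal a * dft N) * ((dft N)ᴴ * Matrix.diagonal b * dft N)
      = (dft N)ᴴ * Matrix.diagonal a * (dft N * (dft N)ᴴ) * Matrix.diagonal b * dft N := by
        simp only [Matrix.mul_assoc]
    _ = (dft N)ᴴ * Matrix.diagonal (fun p => a p * b p) * dft N := by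
        rw [dft_mul_conjTranspose, Matrix.mul_one, Matrix.mul_assoc (dft N)ᴴ,
          Matrix.diagonal_mul_diagonal]

/-- adjoints of Fourier multipliers. [folklore] -/
theorem sandwich_conjTranspose (a : Tor N → ℂ) :
    ((dft N)ᴴ * Matrix.diagonal a * dft N)ᴴ = (dft N)ᴴ * Matrix.diagonal (star a) * dft N := by
  rw [Matrix.conjTranspose_mul, Matrix.conjTranspose_mul, Matrix.conjTranspose_conjTranspose,
    Matrix.diagonal_conjTranspose, Matrix.mul_assoc]

/-- multipliers with the same symbol agree. [folklore] -/
theorem sandwich_congr {a b : Tor N → ℂ} (h : ∀ p, a p = b p) :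
    (dft N)ᴴ * Matrix.diagonal a * dft N = (dft N)ᴴ * Matrix.diagonal b * dft N := by
  rw [show a = b from funext h]

/-- `1 = U^* diag(1) U`. [folklore] -/
theorem one_eq_sandwich : (1 : Matrix (Tor N) (Tor N) ℂ) = (dft N)ᴴ * Matrix.diagonal (fun _ => 1) * dft N := by
  rw [Matrix.diagonal_one, Matrix.mul_one, dft_conjTranspose_mul]

/-- `ΔΔ⁻¹ = I − Pker`. [cite: Balaban1984PropagatorsI, Sect. C p.22] -/
theorem LapS_mul_LapSinv (c : ℂ) : LapS N c * LapSinv N c = 1 - Pker N c := by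
  rw [LapS_eq, LapSinv, sandwich_mul, Pker, one_eq_sandwich, ← Matrix.sub_mul, ← Matrix.mul_sub,
    Matrix.diagonal_sub]
  refine sandwich_congr N fun p => ?_
  by_cases h : lsym N c p = 0
  · simp only [linv, h, if_true, mul_zero, sub_self]
  · simp only [linv, h, if_false, sub_zero, mul_one_div_cancel h]

/-- `Δ⁻¹Δ = I − Pker`. [cite: Balaban1984PropagatorsI, Sect. C p.22] -/
theorem LapSinv_mul_LapS (c : ℂ) : LapSinv N c * LapS N c = 1 - Pker N c := by
  rw [LapS_eq, LapSinv, sandwich_mul, Pker, one_eq_sandwich, ← Matrix.sub_mul, ← Matrix.mul_sub,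
    Matrix.diagonal_sub]
  refine sandwich_congr N fun p => ?_
  by_cases h : lsym N c p = 0
  · simp only [linv, h, if_true, zero_mul, sub_self]
  · simp only [linv, h, if_false, sub_zero, one_div_mul_cancel h]

/-- `Δ⁻¹ Pker = 0`. [folklore] -/
theorem LapSinv_mul_Pker (c : ℂ) : LapSinv N c * Pker N c = 0 := by
  rw [LapSinv, Pker, sandwich_mul]
  have h0 : (fun p => linv N c p * (if lsym N c p = 0 then (1 : ℂ) else 0)) = fun _ => 0 := by
    funext p
    by_cases h : lsym N c p = 0
    · simp only [linv, h, if_true, zero_mul]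
    · simp only [h, if_false, mul_zero]
  rw [h0, Matrix.diagonal_zero, Matrix.mul_zero, Matrix.zero_mul]

/-- `Δ Pker = 0`: `Pker` maps into `ker Δ`. [folklore] -/
theorem LapS_mul_Pker (c : ℂ) : LapS N c * Pker N c = 0 := by
  rw [LapS_eq, Pker, sandwich_mul]
  have h0 : (fun p => lsym N c p * (if lsym N c p = 0 then (1 : ℂ) else 0)) = fun _ => 0 := by
    funext p
    by_cases h : lsym N c p = 0
    · simp only [h, if_true, mul_one]
    · simp only [h, if_false, mul_zero]
  rw [h0, Matrix.diagonal_zero, Matrix.mul_zero, Matrix.zero_mul]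

/-- `Pker² = Pker`. [folklore] -/
theorem Pker_mul_Pker (c : ℂ) : Pker N c * Pker N c = Pker N c := by
  rw [Pker, sandwich_mul]
  refine sandwich_congr N fun p => ?_
  by_cases h : lsym N c p = 0
  · simp only [h, if_true, mul_one]
  · simp only [h, if_false, mul_zero]

/-- `Pkerᴴ = Pker`. [folklore] -/
theorem Pker_conjTranspose (c : ℂ) : (Pker N c)ᴴ = Pker N c := by
  rw [Pker, sandwich_conjTranspose]
  refine sandwich_congr N fun p => ?_
  rw [Pi.star_apply]
  by_cases h : lsym N c p = 0
  · simp only [h, if_true, star_one]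
  · simp only [h, if_false, star_zero]

/-- `(Δ⁻¹)ᴴ = Δ⁻¹`: the typed `Δ⁻¹` is Hermitian. [folklore] -/
theorem LapSinv_conjTranspose (c : ℂ) : (LapSinv N c)ᴴ = LapSinv N c := by
  rw [LapSinv, sandwich_conjTranspose]
  refine sandwich_congr N fun p => ?_
  simp only [Pi.star_apply, linv]
  by_cases h : lsym N c p = 0
  · rw [if_pos h, star_zero]
  · rw [if_neg h, Complex.star_def, map_div₀, map_one, conj_lsym]

/-! ## §3 The printed sentences (`c ≠ 0`) -/

/-- `Pker f` is a constant function (pass 17: `ker Δ` = constants). [folklore] -/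
theorem Pker_const {c : ℂ} (hc : c ≠ 0) (f : Tor N → ℂ) (x : Tor N) :
    (Pker N c *ᵥ f) x = (Pker N c *ᵥ f) 0 :=
  LapS_ker_const N hc _ (by rw [Matrix.mulVec_mulVec, LapS_mul_Pker, Matrix.zero_mulVec]) x

/-- `Pker f = 0` for `f` orthogonal to the constants. [folklore] -/
theorem Pker_orth {c : ℂ} (hc : c ≠ 0) (f : Tor N → ℂ) (hf : ∑ x, f x = 0) : Pker N c *ᵥ f = 0 := by
  have hform := form_of_projection (Pker N c) (Pker_mul_Pker N c) (Pker_conjTranspose N c) f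
  have hzero : star f ⬝ᵥ (Pker N c *ᵥ f) = 0 := by
    have hc' := Pker_const N hc f
    calc star f ⬝ᵥ (Pker N c *ᵥ f) = ∑ x, star (f x) * (Pker N c *ᵥ f) 0 := by
          simp only [dotProduct, Pi.star_apply]
          exact Finset.sum_congr rfl fun x _ => by rw [hc' x]
      _ = star (∑ x, f x) * (Pker N c *ᵥ f) 0 := by rw [← Finset.sum_mul, star_sum]
      _ = 0 := by rw [hf, star_zero, zero_mul]
  exact dotProduct_star_self_eq_zero.mp (hform.trans hzero)

/-- «by Δ⁻¹ we denote its inverse on this subspace»: `ΔΔ⁻¹f = f` for `f ⊥ 1` (`c ≠ 0`).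
[cite: Balaban1984PropagatorsI, Sect. C p.22] -/
theorem LapS_LapSinv_of_orth {c : ℂ} (hc : c ≠ 0) (f : Tor N → ℂ) (hf : ∑ x, f x = 0) :
    LapS N c *ᵥ (LapSinv N c *ᵥ f) = f := by
  rw [Matrix.mulVec_mulVec, LapS_mul_LapSinv, Matrix.sub_mulVec, Matrix.one_mulVec,
    Pker_orth N hc f hf, sub_zero]

/-- … and `Δ⁻¹Δf = f` for `f ⊥ 1` (`c ≠ 0`). [cite: Balaban1984PropagatorsI, Sect. C p.22] -/
theorem LapSinv_LapS_of_orth {c : ℂ} (hc : c ≠ 0) (f : Tor N → ℂ) (hf : ∑ x, f x = 0) :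
    LapSinv N c *ᵥ (LapS N c *ᵥ f) = f := by
  rw [Matrix.mulVec_mulVec, LapSinv_mul_LapS, Matrix.sub_mulVec, Matrix.one_mulVec,
    Pker_orth N hc f hf, sub_zero]

/-- «putting its value on constant functions equal to 0»: `Δ⁻¹(const) = 0`.
[cite: Balaban1984PropagatorsI, Sect. C p.22] -/
theorem LapSinv_const (c a : ℂ) : LapSinv N c *ᵥ (fun _ : Tor N => a) = 0 := by
  have h1 : (LapSinv N c * LapS N c) *ᵥ (fun _ : Tor N => a)
      = (1 - Pker N c) *ᵥ (fun _ : Tor N => a) := by rw [LapSinv_mul_LapS]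
  rw [← Matrix.mulVec_mulVec, LapS_const, Matrix.mulVec_zero, Matrix.sub_mulVec,
    Matrix.one_mulVec] at h1
  have h2 : Pker N c *ᵥ (fun _ : Tor N => a) = fun _ => a := (sub_eq_zero.mp h1.symm).symm
  calc LapSinv N c *ᵥ (fun _ : Tor N => a) = LapSinv N c *ᵥ (Pker N c *ᵥ fun _ => a) := by rw [h2]
    _ = (LapSinv N c * Pker N c) *ᵥ fun _ => a := by rw [Matrix.mulVec_mulVec]
    _ = 0 := by rw [LapSinv_mul_Pker, Matrix.zero_mulVec]

/-- «by linearity»: the typed `Δ⁻¹` maps every function into the subspace orthogonal to constants.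
[cite: Balaban1984PropagatorsI, Sect. C p.22] -/
theorem sum_LapSinv (c : ℂ) (f : Tor N → ℂ) : ∑ x, (LapSinv N c *ᵥ f) x = 0 := by
  have h1 : ∑ x, (LapSinv N c *ᵥ f) x = star (fun _ : Tor N => (1 : ℂ)) ⬝ᵥ (LapSinv N c *ᵥ f) := by
    simp [dotProduct]
  rw [h1, dotProduct_mulVec, ← LapSinv_conjTranspose, ← Matrix.star_mulVec, LapSinv_const, star_zero,
    zero_dotProduct]

/-! ## §4 Re-typing of pass 18's `residual_eq` on the FULL torus (answer to GAPS G-adv2-27)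

Pass 18 (`B5Projection127.residual_eq`) assumed `D·L = 1`, which the printed `Δ`, `Δ⁻¹` satisfy
only on the complement of the constants (`ΔΔ⁻¹ = I − Pker` here). The pseudo-inverse version
below (hypotheses `D L b = b`, `D L L = L`, as suggested by the cross-read G-adv2-27) holds for the
typed `Δ`, `Δ⁻¹` on all of `L²(T_η)` for `b ⊥ 1` — e.g. `b = ∂^*A` (pass 15
`B5DivOrth.divS_orth_const`) — with NO hypothesis on `Q`, `Minv`. -/

section Residual

variable {m k : Type*} [Fintype m] [Fintype k] [DecidableEq m] [DecidableEq k]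

omit hN [DecidableEq k] in
/-- `A − Δλ₀ = Pc(A)`-bookkeeping under pseudo-inverse hypotheses: if `D L b = b` and
`D L L = L` then `b − D L (I − Pc) b = Pc b`. [folklore] -/
theorem residual_eq_pinv (L D : Matrix m m ℂ) (Q : Matrix k m ℂ) (Minv : Matrix k k ℂ)
    (hDLL : D * L * L = L) (b : m → ℂ) (hb : D *ᵥ (L *ᵥ b) = b) :
    b - D *ᵥ (L *ᵥ ((1 - Pc L Q Minv) *ᵥ b)) = Pc L Q Minv *ᵥ b := by
  have hDLPc : D * L * Pc L Q Minv = Pc L Q Minv := by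
    simp only [Pc, ← Matrix.mul_assoc]; rw [hDLL]
  rw [Matrix.sub_mulVec, Matrix.one_mulVec, Matrix.mulVec_sub, Matrix.mulVec_sub, hb]
  simp only [Matrix.mulVec_mulVec, ← Matrix.mul_assoc]
  rw [hDLPc, sub_sub_cancel]

end Residual

/-- `Pker Δ⁻¹ = 0`: `Ran Δ⁻¹ ⊥` constants. [folklore] -/
theorem Pker_mul_LapSinv (c : ℂ) : Pker N c * LapSinv N c = 0 := by
  rw [LapSinv, Pker, sandwich_mul]
  have h0 : (fun p => (if lsym N c p = 0 then (1 : ℂ) else 0) * linv N c p) = fun _ => 0 := by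
    funext p
    by_cases h : lsym N c p = 0
    · simp only [linv, h, if_true, mul_zero]
    · simp only [h, if_false, zero_mul]
  rw [h0, Matrix.diagonal_zero, Matrix.mul_zero, Matrix.zero_mul]

/-- `ΔΔ⁻¹Δ⁻¹ = Δ⁻¹`. [folklore] -/
theorem LapS_mul_LapSinv_mul_LapSinv (c : ℂ) : LapS N c * LapSinv N c * LapSinv N c = LapSinv N c := by
  rw [LapS_mul_LapSinv, Matrix.sub_mul, Matrix.one_mul, Pker_mul_LapSinv, sub_zero]

/-- the substitution identity of p. 22 for the typed `Δ`, `Δ⁻¹` on the full torus: for `b ⊥ 1`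
(`c ≠ 0`) and ANY `Q`, `Minv`, `b − Δ Δ⁻¹(I − Pc)b = Pc b` with
`Pc = Δ⁻¹Qᴴ Minv Q Δ⁻¹`. [cite: Balaban1984PropagatorsI, (1.26) p.22] -/
theorem residual_eq_torus {c : ℂ} (hc : c ≠ 0) {k : Type*} [Fintype k]
    (Q : Matrix k (Tor N) ℂ) (Minv : Matrix k k ℂ) (b : Tor N → ℂ) (hb : ∑ x, b x = 0) :
    b - LapS N c *ᵥ (LapSinv N c *ᵥ ((1 - Pc (LapSinv N c) Q Minv) *ᵥ b))
      = Pc (LapSinv N c) Q Minv *ᵥ b :=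
  residual_eq_pinv (LapSinv N c) (LapS N c) Q Minv (LapS_mul_LapSinv_mul_LapSinv N c) b
    (LapS_LapSinv_of_orth N hc b hb)

end

end Literature.MathematicalPhysics.QuantumFieldTheory.Balaban1983to89.B5LaplaceInverse
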